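import Summits.BirchSwinnertonDyer.BirchSwinnertonDyer.Theorems.ResidualThetaTransportAtTwoThetaLayerLambdaCongruenceAtTwoCuspSpanRowsTwoFour
import HarnessLib

/-!
# Route `ResidualThetaTransportAtTwo`, cruxes Kan⁺ (stmt-BirchSwinnertonDyer-20688) / node 27436 / 21437: ALL the 2-power rows
# `|b| = 2^j` of `Γ₀(N)` are killed for free (every odd level `N`, every `j ≥ 0`)

Cell `bsd-wall`, width seat `bsd-wall-rtt-p3-w3` g8 (2026-08-28), lane «2-power descent». THEOREMS ONLY;
`--supports stmt-BirchSwinnertonDyer-20688`; BSD is not proved by this.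

`rtt-p3-w4` g2 (`…CuspSpanRowsTwoFour`, p639370) proved that an additive `χ : Γ₀(N) → 𝔽₂` (`N` odd) killing the elements of trace
`0, ±1, ±2`, the elements with `|d| = 4^k` (`k ≥ 1`) and the row `b = −1` kills the rows `|b| = 2` (Dirichlet prime `P ≡ 7 (mod 8)`,
Euler) and `|b| = 4^i` (Fermat), by the mechanism `chi_eq_zero_of_b_neg_of_prime_dvd`: `γ = (a, −m; Nc, d)`, `P ≡ a (mod mN)`,
`P ∣ m 4^k − 1` ⟹ `γ L_t σ ∈ B₁` for `σ = (x, u; Ny, 4^k)`. HERE the remaining rows `|b| = 2^j`, `j` odd `≥ 3`, follow from the same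
mechanism with BOTH signs free:
* §1 `chi_eq_zero_of_b_neg_of_prime_dvd_add` — the mechanism with `P ∣ m 4^k + 1` (use `σ = (x, −u; Ny, −4^k)`, still killed);
* §2 `exists_dvd_two_pow_mul_four_pow_sub_one_or_add_one` — for a prime `P ≡ 3 (mod 4)`, `P = 4t + 3`, and any `j`: with
  `k = jt + 2t + 1` one has `j + 2k = (2t+1)(j+2)`, so `2^j 4^k = (2^{(P−1)/2})^{j+2} ≡ (±1)^{j+2}` (Fermat: `(2^{(P−1)/2})² ≡ 1`) —
  hence `P ∣ 2^j 4^k − 1` or `P ∣ 2^j 4^k + 1`; no Euler criterion, no Artin condition;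
* §3 **`chi_eq_zero_of_natAbs_b_eq_two_pow_odd`** — `|b| = 2^j` is killed for every `j`: take `ε = ±1` with `εa ≡ 3 (mod 4)`, a Dirichlet
  prime `P' ≡ εa (mod 4·2^j·N)`, and `P = εP'` (the mechanism allows any integer `P`).
This is the input «rows `|b| = 2^j`, `j ≤ J`» of the 2-power descent (`…CuspSpanTwoPowDescent.chi_eq_zero_of_descent`) for every `J`;
three distinct primes need `J = 3`.

References: [Rademacher1929] §1; [Pollack2003] Conj. 6.3; [IrelandRosen1990] Ch. 4–5; Dirichlet / Mathlib
`Nat.forall_exists_prime_gt_and_zmodEq`.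
-/

set_option autoImplicit false
set_option linter.dupNamespace false

open scoped MatrixGroups

open CongruenceSubgroup

namespace Summit.BirchSwinnertonDyer.BirchSwinnertonDyer.Theorems.SignedMuAtTwo

namespace TwoPow

variable {N : ℕ} {χ : Gamma0 N → ZMod 2}

/-! ## §1. The mechanism with the other sign -/

/-- **Row killing from `P ≡ a (mod mN)` dividing `m·4^k + 1`.** Let `χ` be additive, kill the small-trace elements, the
`|d| = 4^k` elements and the row `b = −1`; let `γ = (a, −m; Nc, d) ∈ Γ₀(N)` (`N` odd), `P` with `mN ∣ a − P`, `k ≥ 1`, `P ∣ m 4^k + 1`.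
Then `χ γ = 0` (with `σ = (x, −u; Ny, −4^k)`, `P u = m 4^k + 1`, the product `γ L_t σ` has upper-right entry `−Pu + m4^k = −1`).
[cite: Rademacher1929, §1] -/
theorem chi_eq_zero_of_b_neg_of_prime_dvd_add [NeZero N] (hN : Odd N)
    (hadd : ∀ γ δ : Gamma0 N, χ (γ * δ) = χ γ + χ δ)
    (hsmall : ∀ γ : Gamma0 N, ((γ : SL(2, ℤ)) 0 0 + (γ : SL(2, ℤ)) 1 1).natAbs ≤ 2 → χ γ = 0)
    (hkill : ∀ γ : Gamma0 N, (∃ k : ℕ, 1 ≤ k ∧ ((γ : SL(2, ℤ)) 1 1).natAbs = 4 ^ k) → χ γ = 0)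
    (hB1 : ∀ β : Gamma0 N, (β : SL(2, ℤ)) 0 1 = -1 → χ β = 0)
    {γ : Gamma0 N} (m : ℕ) (hb : (γ : SL(2, ℤ)) 0 1 = -(m : ℤ))
    (P : ℤ) (hPa : ((m * N : ℕ) : ℤ) ∣ (γ : SL(2, ℤ)) 0 0 - P) (k : ℕ) (hk : 1 ≤ k)
    (hPdvd : P ∣ (m : ℤ) * 4 ^ k + 1) : χ γ = 0 := by
  -- move `a` to `P` by a right `L_t`
  obtain ⟨t, ht⟩ := hPa
  obtain ⟨L, hL00, hL01, hL10, hL11⟩ :=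
    ThetaLayerLambdaCongruenceAtTwo.exists_gamma0_entries (N := N) 1 0 ((N : ℤ) * t) 1 (by ring) (dvd_mul_right _ _)
  have hL : χ L = 0 := hsmall L (by rw [hL00, hL11]; decide)
  have g00 : ((γ * L : Gamma0 N) : SL(2, ℤ)) 0 0 = P := by
    rw [gamma0_mul_apply_zero_zero', hL00, hL10, hb]; push_cast at ht; linear_combination ht
  have g01 : ((γ * L : Gamma0 N) : SL(2, ℤ)) 0 1 = -(m : ℤ) := by
    rw [gamma0_mul_apply_zero_one, hL01, hL11, hb]; ring
  -- the `4^k`-element `σ = (x, −u; Ny, −4^k)`, `P u = m 4^k + 1`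
  obtain ⟨u, hu⟩ := hPdvd
  have huodd : Odd u := by
    have h1 : Odd ((m : ℤ) * 4 ^ k + 1) := by
      have : Even ((m : ℤ) * 4 ^ k) := by
        obtain ⟨k', rfl⟩ : ∃ k', k = k' + 1 := ⟨k - 1, by omega⟩
        exact ⟨(m : ℤ) * 4 ^ k' * 2, by ring⟩
      exact this.add_odd odd_one
    rw [hu] at h1
    exact (Int.odd_mul.mp h1).2
  have hNodd : Odd (N : ℤ) := by exact_mod_cast hN
  have hcop : IsCoprime ((4 : ℤ) ^ k) (u * N) := by
    have h2 : IsCoprime (2 : ℤ) (u * N) := by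
      obtain ⟨w, hw⟩ := huodd.mul hNodd
      exact ⟨-w, 1, by rw [hw]; ring⟩
    rw [show ((4 : ℤ)) ^ k = 2 ^ (2 * k) by rw [pow_mul]; norm_num]
    exact h2.pow_left
  obtain ⟨x, y, hxy⟩ := hcop
  obtain ⟨σ, s00, s01, s10, s11⟩ :=
    ThetaLayerLambdaCongruenceAtTwo.exists_gamma0_entries (N := N) (-x) (-u) ((N : ℤ) * y) (-(4 ^ k))
      (by linear_combination hxy) (dvd_mul_right _ _)
  have hσ : χ σ = 0 := hkill σ ⟨k, hk, by rw [s11, Int.natAbs_neg, Int.natAbs_pow]; rfl⟩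
  -- the product lands in `B₁`
  have hprod : ((γ * L * σ : Gamma0 N) : SL(2, ℤ)) 0 1 = -1 := by
    rw [gamma0_mul_apply_zero_one, g00, g01, s01, s11]; linear_combination hu
  have h0 := hB1 _ hprod
  rw [hadd, hadd, hL, hσ, add_zero, add_zero] at h0
  exact h0

/-! ## §2. `2^j · 4^k ≡ ±1` modulo a prime `P ≡ 3 (mod 4)` -/

/-- **For a prime `P ≡ 3 (mod 4)` and any `j` there is `k ≥ 1` with `P ∣ 2^j 4^k − 1` or `P ∣ 2^j 4^k + 1`.** With `P = 4t + 3`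
and `k = jt + 2t + 1`: `j + 2k = (2t+1)(j+2)` and `2^{2t+1} = 2^{(P−1)/2} ≡ ±1` (its square is `2^{P−1} ≡ 1`, Fermat).
[cite: IrelandRosen1990, Ch. 4 §1] -/
theorem exists_dvd_two_pow_mul_four_pow_sub_one_or_add_one (P : ℕ) (hP : P.Prime) (h3 : P % 4 = 3) (j : ℕ) :
    ∃ k : ℕ, 1 ≤ k ∧ ((P : ℤ) ∣ 2 ^ j * 4 ^ k - 1 ∨ (P : ℤ) ∣ 2 ^ j * 4 ^ k + 1) := by
  haveI := Fact.mk hP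
  set t : ℕ := P / 4 with ht
  have hPt : P = 4 * t + 3 := by omega
  refine ⟨j * t + 2 * t + 1, by omega, ?_⟩
  have h2ne : (2 : ZMod P) ≠ 0 := by
    intro h
    have : ((2 : ℕ) : ZMod P) = 0 := by exact_mod_cast h
    rw [ZMod.natCast_eq_zero_iff] at this
    have := Nat.le_of_dvd (by norm_num) this; omega
  set x : ZMod P := 2 ^ (2 * t + 1) with hx
  have hxx : x * x = 1 := by
    rw [hx, ← pow_add, show 2 * t + 1 + (2 * t + 1) = P - 1 by omega]
    exact ZMod.pow_card_sub_one_eq_one h2ne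
  have hpow : (2 : ZMod P) ^ j * 4 ^ (j * t + 2 * t + 1) = x ^ (j + 2) := by
    rw [hx, show (4 : ZMod P) = 2 ^ 2 by norm_num, ← pow_mul, ← pow_add, ← pow_mul]
    congr 1; ring
  rcases mul_self_eq_one_iff.mp hxx with h1 | h1
  · left
    rw [← ZMod.intCast_zmod_eq_zero_iff_dvd]; push_cast
    rw [hpow, h1, one_pow, sub_self]
  · rcases Nat.even_or_odd j with hj | hj
    · left
      rw [← ZMod.intCast_zmod_eq_zero_iff_dvd]; push_cast
      rw [hpow, h1, (hj.add (even_two)).neg_one_pow, sub_self]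
    · right
      rw [← ZMod.intCast_zmod_eq_zero_iff_dvd]; push_cast
      rw [hpow, h1, (hj.add_even (even_two)).neg_one_pow, neg_add_cancel]

/-! ## §3. Every row `|b| = 2^j` is killed -/

/-- **`|b| = 2^j` is killed at every odd level, for every `j ≥ 0`.** (`j = 0` is the hypothesis; `j = 1` and `j` even are
`rtt-p3-w4`'s rows; `j` odd `≥ 3` is new.) [cite: Pollack2003, Conj. 6.3] [cite: Rademacher1929, §1] -/
theorem chi_eq_zero_of_natAbs_b_eq_two_pow_odd [NeZero N] (hN : Odd N)
    (hadd : ∀ γ δ : Gamma0 N, χ (γ * δ) = χ γ + χ δ)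
    (hsmall : ∀ γ : Gamma0 N, ((γ : SL(2, ℤ)) 0 0 + (γ : SL(2, ℤ)) 1 1).natAbs ≤ 2 → χ γ = 0)
    (hkill : ∀ γ : Gamma0 N, (∃ k : ℕ, 1 ≤ k ∧ ((γ : SL(2, ℤ)) 1 1).natAbs = 4 ^ k) → χ γ = 0)
    (hB1 : ∀ β : Gamma0 N, (β : SL(2, ℤ)) 0 1 = -1 → χ β = 0)
    (j : ℕ) (γ : Gamma0 N) (hb : ((γ : SL(2, ℤ)) 0 1).natAbs = 2 ^ j) : χ γ = 0 := by
  -- reduce to `b = −2^j`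
  wlog hneg : (γ : SL(2, ℤ)) 0 1 = -((2 ^ j : ℕ) : ℤ) generalizing γ
  · have hpos : (γ : SL(2, ℤ)) 0 1 = ((2 ^ j : ℕ) : ℤ) := by
      rcases Int.natAbs_eq_iff.mp hb with h | h
      · exact h
      · exact absurd h hneg
    rw [← Potential.chi_inv hadd γ]
    exact this γ⁻¹ (by rw [coe_inv_apply_zero_one, hpos, Int.natAbs_neg]; simp) (by rw [coe_inv_apply_zero_one, hpos])
  rcases Nat.eq_zero_or_pos j with hj | hj
  · subst hj; exact hB1 γ (by rw [hneg]; simp)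
  set a : ℤ := (γ : SL(2, ℤ)) 0 0 with ha_def
  -- `a` is prime to `2^j N`, hence odd and prime to `4 · 2^j · N`
  have hcopa : IsCoprime a ((2 ^ j * N : ℕ) : ℤ) := by
    have h := isCoprime_apply_zero_zero_mul γ
    rw [hneg] at h
    push_cast at h ⊢
    rw [show (2 : ℤ) ^ j * N = -(-(2 ^ j) * (N : ℤ)) by ring]
    exact h.neg_right
  have ha2 : IsCoprime a 2 := by
    have h1 : IsCoprime a ((2 : ℤ) ^ j) := by
      have := hcopa; push_cast at this; exact this.of_mul_right_left
    obtain ⟨j', rfl⟩ : ∃ j', j = j' + 1 := ⟨j - 1, by omega⟩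
    rw [pow_succ] at h1
    exact h1.of_mul_right_right
  have haodd : a % 4 = 1 ∨ a % 4 = 3 := by
    obtain ⟨u, v, huv⟩ := ha2
    have : ¬ (2 : ℤ) ∣ a := by
      rintro ⟨c, hc⟩; rw [hc] at huv
      have : (1 : ℤ) = 2 * (u * c + v) := by linear_combination -huv
      omega
    omega
  -- the sign `ε` with `ε a ≡ 3 (mod 4)`
  obtain ⟨ε, hε, hεa⟩ : ∃ ε : ℤ, (ε = 1 ∨ ε = -1) ∧ (ε * a) % 4 = 3 := by
    rcases haodd with h | h
    · exact ⟨-1, Or.inr rfl, by omega⟩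
    · exact ⟨1, Or.inl rfl, by omega⟩
  have hεsq : ε * ε = 1 := by rcases hε with rfl | rfl <;> norm_num
  have hcopM : IsCoprime (ε * a) ((4 * (2 ^ j * N) : ℕ) : ℤ) := by
    have hεcop : IsCoprime ε ((4 * (2 ^ j * N) : ℕ) : ℤ) := ⟨ε, 0, by rw [zero_mul, add_zero]; exact hεsq⟩
    refine hεcop.mul_left ?_
    push_cast
    refine IsCoprime.mul_right ?_ ?_
    · rw [show (4 : ℤ) = 2 ^ 2 by norm_num]; exact ha2.pow_right
    · have := hcopa; push_cast at this; exact this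
  have hM0 : 4 * (2 ^ j * N) ≠ 0 := Nat.mul_ne_zero (by norm_num) (Nat.mul_ne_zero (pow_ne_zero _ two_ne_zero) (NeZero.ne N))
  obtain ⟨P', _, hP'p, hP'dvd⟩ := exists_prime_sub_dvd (4 * (2 ^ j * N)) hM0 (ε * a) hcopM 2
  -- `P' ≡ 3 (mod 4)`
  have hP'3 : P' % 4 = 3 := by
    have h4 : (4 : ℤ) ∣ ε * a - P' := (Int.dvd_mul_right 4 ((2 ^ j * N : ℕ) : ℤ)).trans (by exact_mod_cast hP'dvd)
    omega
  obtain ⟨k, hk, hPk⟩ := exists_dvd_two_pow_mul_four_pow_sub_one_or_add_one P' hP'p hP'3 j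
  -- `P = ε P'`, `2^j N ∣ a − P`
  set P : ℤ := ε * P' with hP_def
  have hPa : ((2 ^ j * N : ℕ) : ℤ) ∣ a - P := by
    have h1 : ((2 ^ j * N : ℕ) : ℤ) ∣ ε * a - P' :=
      (Int.dvd_mul_left 4 ((2 ^ j * N : ℕ) : ℤ)).trans (by exact_mod_cast hP'dvd)
    have h2 := h1.mul_left ε
    have e : ε * (ε * a - P') = a - P := by rw [hP_def]; linear_combination a * hεsq
    rwa [e] at h2
  have hεdvd : ∀ z : ℤ, (P' : ℤ) ∣ z → P ∣ z := by
    intro z hz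
    rcases hε with h | h
    · rw [hP_def, h, one_mul]; exact hz
    · rw [hP_def, h, neg_one_mul]; exact (Int.neg_dvd).mpr hz
  rcases hPk with h | h
  · exact chi_eq_zero_of_b_neg_of_prime_dvd hN hadd hsmall hkill hB1 (2 ^ j) hneg P hPa k hk
      (by push_cast; exact hεdvd _ h)
  · exact chi_eq_zero_of_b_neg_of_prime_dvd_add hN hadd hsmall hkill hB1 (2 ^ j) hneg P hPa k hk
      (by push_cast; exact hεdvd _ h)

/-- **All 2-power rows at once** (the shape consumed by `chi_eq_zero_of_descent`): for every `J`, every `j ≤ J` and every `γ`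
with `|b(γ)| = 2^j`, `χ γ = 0`. [cite: Pollack2003, Conj. 6.3] -/
theorem rows_two_pow_odd [NeZero N] (hN : Odd N)
    (hadd : ∀ γ δ : Gamma0 N, χ (γ * δ) = χ γ + χ δ)
    (hsmall : ∀ γ : Gamma0 N, ((γ : SL(2, ℤ)) 0 0 + (γ : SL(2, ℤ)) 1 1).natAbs ≤ 2 → χ γ = 0)
    (hkill : ∀ γ : Gamma0 N, (∃ k : ℕ, 1 ≤ k ∧ ((γ : SL(2, ℤ)) 1 1).natAbs = 4 ^ k) → χ γ = 0)
    (hB1 : ∀ β : Gamma0 N, (β : SL(2, ℤ)) 0 1 = -1 → χ β = 0) (J : ℕ) :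
    ∀ j : ℕ, j ≤ J → ∀ γ : Gamma0 N, ((γ : SL(2, ℤ)) 0 1).natAbs = 2 ^ j → χ γ = 0 :=
  fun j _ γ hγ ↦ chi_eq_zero_of_natAbs_b_eq_two_pow_odd hN hadd hsmall hkill hB1 j γ hγ

end TwoPow

end Summit.BirchSwinnertonDyer.BirchSwinnertonDyer.Theorems.SignedMuAtTwo
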